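import Summits.BirchSwinnertonDyer.BirchSwinnertonDyer.Theorems.SignedLowerHalvesSmallImageLowerHalfBothSignsRttJunctionShaRhoTwo
import Summits.BirchSwinnertonDyer.BirchSwinnertonDyer.Theorems.SignedLowerHalvesSmallImageLowerHalfBothSignsRttJunctionShaLocCountAtP
import Summits.BirchSwinnertonDyer.BirchSwinnertonDyer.Theorems.SignedLowerHalvesSmallImageLowerHalfBothSignsRttD2SeqJ3HS2Plumb
import HarnessLib

/-!
# Route `SignedLowerHalves`, crux L `SmallImageLowerHalfBothSigns` (stmt-BirchSwinnertonDyer-23599), line `rtt_w3` v30 — stub S3α′ (`stub_junctionShaPT_ns`):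
# ★★★ S3α′ MINUS ITS POITOU–TATE MAP, IN THE FRAME'S VOCABULARY — `∃ Loc, Finite Loc, ρ : I₂.H →ₗ[Λ] Loc` with `ker ρ` = the classes locally trivial at every place above `supp(p𝔣)` of every layer,
# from clause (R) of `CharRoadFrameSupp`, the exponent of `θ′` on inertia, and the ONE displayed input at `vp` (height-two / Imai)

INPUTS hand `bsd-inputs-honda-p1` g28 under LEAD `cruxlead-stmt-BirchSwinnertonDyer-23599` g14 (cell `bsd-ssimc`); helper `--supports stmt-BirchSwinnertonDyer-23599`. THEOREMS ONLY.
WHAT. `exists_rhoTwo_finite_of_frameSupp`: for the restricted cyclotomic tower `κ_K` of the quadratic field `K`, `θ′` with (R) and exponent `m₀ ≠ 0` on the inertia away from `p`, `𝔣 ≠ ⊥`,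
`N_{supp(p𝔣)} ≤ U_n`, and — the displayed input — at each place of `supp(p𝔣)` above `p`: non-split in the tower and ONE `τ` over `K_∞` fixing `μ_{p^∞}(K̄_v)` with `θ′(res τ) ≠ 1`: for honda's
degree-2 datum `I₂` (stub currency `letI := I₂.moduleIwasawa`) there are a FINITE `Λ`-module `Loc` and a `Λ`-linear `ρ : I₂.H → Loc` whose kernel is exactly the set of classes all of whose level
components are locally trivial at every place above `supp(p𝔣)` (= `Ш²`, levelwise). With it the REGISTERED S3α′ is reduced to α5′ alone: a `Λ`-linear `π : Y′ → I₂.H` whose range contains these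
classes (-w3 lineage, HELPER-TABLE add. 30). Assembled from ρ₂ (p814071), `exists_rhoTwo_loc` (p815508), the levelwise bounds (p814394/p814993/`…AtP`) and LEAD g14's limit lemma (p813183).
HONEST FRAMING: conditional on the displayed `vp`-input; nothing about S3α′, E2, crux L or BSD is proved; all remain OPEN and are proved for NO curve.
References: [NeukirchSchmidtWingberg2008] (8.6.3), (8.6.10); [PerrinRiou1994Invent] §1.3; [Imai1975] Theorem (p. 12).
-/

set_option autoImplicit false
set_option linter.dupNamespace false -- D-0017: single-problem summit, the namespace repeats the problem name by design
noncomputable section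

open scoped Classical
open NumberField IsDedekindDomain Field CategoryTheory Function

namespace Summit.BirchSwinnertonDyer.BirchSwinnertonDyer.Theorems.SmallImageRttJunctionSha

open Literature.NumberTheory.EllipticCurves Literature.NumberTheory.GaloisRepresentations Literature.NumberTheory.GaloisRepresentations.DiscreteGaloisModule
  Literature.NumberTheory.ComplexMultiplication.EllipticUnits.JohnsonLeungKings2011
  Summit.BirchSwinnertonDyer.BirchSwinnertonDyer.Theorems.SmallImageRttD2J1
  Summit.BirchSwinnertonDyer.BirchSwinnertonDyer.Theorems.SmallImageRttD2Seq

section Frame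

variable {p : ℕ} [Fact p.Prime] (hp : p ≠ 2) {κ : ZpExtension ℚ p} {K : Type} [Field K] [NumberField K] (hK2 : Module.finrank ℚ K = 2)

/-- ★★★ **S3α′ MINUS `π`**: a finite `Λ`-module `Loc` and a `Λ`-linear `ρ : I₂.H → Loc` whose kernel is the levelwise `Ш²` at `supp(p𝔣)` — from (R), the inertia exponent of `θ′`, and the ONE
displayed input at the places above `p`. [cite: NeukirchSchmidtWingberg2008, (8.6.3), (8.6.10)] [cite: PerrinRiou1994Invent, §1.3] [cite: Imai1975, Theorem (p. 12)] -/
theorem exists_rhoTwo_finite_of_frameSupp (S : Set (PadicAlgCl p)) [FiniteDimensional ℚ_[p] (padicCoeffField S)]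
    (hκ : κ.IsCyclotomic) {γ : absoluteGaloisGroup ℚ} (hγ : κ.IsTopGenerator γ) (hcv : IsCyclotomicVariable p γ)
    (θ' : absoluteGaloisGroup K →ₜ* (padicCoeffIntegers S)ˣ) {𝔣 : Ideal (𝓞 K)} (h𝔣 : 𝔣 ≠ ⊥)
    (hR : ∀ w ∈ suppPF p 𝔣, ((p : ℕ) : 𝓞 K) ∉ w.asIdeal → ∃ 𝔓 ∈ w.primesAbove, ∃ τ ∈ 𝔓.inertia (absoluteGaloisGroup K), θ' τ ≠ 1)
    {m₀ : ℕ} (hm₀ : m₀ ≠ 0)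
    (hθm : ∀ w : HeightOneSpectrum (𝓞 K), ((p : ℕ) : 𝓞 K) ∉ w.asIdeal → ∀ 𝔓 ∈ w.primesAbove, ∀ τ ∈ 𝔓.inertia (absoluteGaloisGroup K), θ' τ ^ m₀ = 1)
    (hvp : ∀ w ∈ suppPF p 𝔣, ((p : ℕ) : 𝓞 K) ∈ w.asIdeal →
      AcSigned.IsNonsplitIn (κ.restrictOfFinrankEqTwo hp K hK2) w ∧
        ∃ τ : absoluteGaloisGroup (w.adicCompletion K),
          (∀ n, resGalOfEmb (closureEmb (K := K) (w.adicCompletion K)) τ ∈ (κ.restrictOfFinrankEqTwo hp K hK2).layerSubgroup n) ∧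
          (∀ (k : ℕ) (ζ : MuCarrier (w.adicCompletion K) (p ^ k)), mu (w.adicCompletion K) (p ^ k) τ ζ = ζ) ∧
          θ' (resGalOfEmb (closureEmb (K := K) (w.adicCompletion K)) τ) ≠ 1)
    (hNP : ∀ n, ramificationSubgroup K (suppPF p 𝔣) ≤ (κ.restrictOfFinrankEqTwo hp K hK2).layerSubgroup n)
    {γK : absoluteGaloisGroup K} (I : CycIwasawaCohomologyDataO S (κ.restrictOfFinrankEqTwo hp K hK2) γK θ' (suppPF p 𝔣) 2) :
    letI := I.moduleIwasawa
    ∃ (Loc : Type) (_ : AddCommGroup Loc) (_ : Module (IwasawaAlgebra p) Loc) (_ : Finite Loc) (ρ : I.H →ₗ[IwasawaAlgebra p] Loc),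
      ∀ b : I.H, ρ b = 0 ↔ ∀ w ∈ suppPF p 𝔣, ∀ (n k : ℕ) (δ : absoluteGaloisGroup K),
        ContinuousCohomology.map (locLayerHom (κ.restrictOfFinrankEqTwo hp K hK2) (suppPF p 𝔣) w n)
          (locLayerMod S (κ.restrictOfFinrankEqTwo hp K hK2) θ' (suppPF p 𝔣) w n k) 2
          (cycLayerConjO S (κ.restrictOfFinrankEqTwo hp K hK2) θ' (suppPF p 𝔣) n k 2 δ (I.proj n k b)) = 0 := by
  obtain ⟨Loc, i1, i2, ρ, hker, hfin⟩ := exists_rhoTwo_loc hNP (suppPF p 𝔣) I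
  refine ⟨Loc, i1, i2, hfin (SmallImageRttD2Seq.finite_suppPF_of_ne_bot h𝔣) (fun w hw ↦ ?_), ρ, hker⟩
  by_cases hwp : ((p : ℕ) : 𝓞 K) ∈ w.asIdeal
  · obtain ⟨hv, τ, hτU, hτμ, hτθ⟩ := hvp w hw hwp
    exact exists_bound_semilocCoh_two_of_apply_ne_one S (κ.restrictOfFinrankEqTwo hp K hK2) θ' (suppPF p 𝔣) w hv hτU hτμ hτθ
  · exact exists_bound_semilocCoh_two_of_frameSupp hp hK2 S hκ hγ hcv θ' 𝔣 hR hm₀ hθm hw hwp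

end Frame

end Summit.BirchSwinnertonDyer.BirchSwinnertonDyer.Theorems.SmallImageRttJunctionSha

end
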